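/-
Copyright (c) 2026 the pub-hodgecm-mathlib formalisation cell (harness21).  Prover seat hodgecm-mathlib-LH3-p04 (g3): LH3 «Transf» road,
organ (M2) `hcont` (dealer LH3-plan (g3) board #1 (i) 2026-09-02), generic piece (3) «corners» of the census 2026-09-02T07:11Z.
-/
import Literature.Analysis.Calculus.SmoothGluingAcrossHyperplane
import HarnessLib

/-!
# Smooth gluing across a finite transversal arrangement of hyperplanes (the corners)

Analysis/Calculus support file (everything PROVED; no definition, no named fact, no `sorry`).  Sequel of
`SmoothGluingAcrossHyperplane.lean` (★ (GLUE-X-gen), ONE wall).  The situation of A. Bouaziz, *Intégrales orbitales sur les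
groupes de Lie réductifs*, Ann. Sci. ÉNS 27 (1994), §3.2 p. 579, property (I₂) «`ψ_H` se prolonge en une fonction `C^∞` sur
`H_{in-reg} ∩ U`» at the points of `H_{in-reg}` where SEVERAL walls meet (several compact imaginary roots equal to `1`, or a
compact-root wall meeting a real-root wall): there the regular set is, locally, the complement of a finite TRANSVERSAL
arrangement of hyperplanes, and smoothness across each wall at its SIMPLE points (where no other wall passes — the only points
at which orbital-integral jump data are available, D. Shelstad, *Characters and inner forms of a quasi-split group over `ℝ`*,
Compositio Math. 39 (1979), §4 p. 22 «exactly two imaginary roots `±α` with `ξ_{±α}(γ₀) = 1`») already forces smoothness at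
the corners.  This file is the formal content of that remark; it is group-free.

Let `E` be a real normed space, `F` a complete real normed space, `U ⊆ E` open, and `(ℓ i, a i)_{i ∈ T}` a finite family of
affine hyperplanes («walls», `ℓ i ≠ 0`), TRANSVERSAL in `U`: at each point `x ∈ U` of the wall `i` there is a direction `v`
INSIDE the wall `i` (`ℓ i v = 0`) leaving every other wall through `x` (`ℓ j v ≠ 0` whenever `ℓ j x = a j`, `j ≠ i`).  Put
`s := U ∩ {∀ i ∈ T, ℓ i ≠ a i}` (open, dense in `U`).  Let `f : E → F` be `C^∞` on `s` with every jet `Dⁿ f` locally bounded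
on `s` near each wall point of `U` (Bouaziz (I₁)), and suppose the glue `g := extendFrom s f` is `C^∞` on a neighbourhood of
every SIMPLE wall point (a point of `U` on exactly one wall).  MAIN THEOREM (`contDiffOn_extendFrom_of_arrangement`): `g` is
`C^∞` on all of `U`.

Proof: induction on the walls.  Having glued across the walls of `T` on `U′ := U ∩ {ℓ i ≠ a i}`, one glues across the wall
`i` on `U` by ★ `contDiffOn_extendFrom_of_oneSidedLimits_eq`: the jets of `g` stay locally bounded off the wall `i` (they are
limits of jets of `f`, `s` being dense), and at a wall-`i` point `x` the two one-sided limits of `Dⁿ g` agree — at a simple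
point because `g` is `C^∞` there; at a CORNER because `Dⁿ g` is Lipschitz on each of the two open half-balls at `x` (mean value
inequality from the bound on `Dⁿ⁺¹ g`, ★ `lipschitzOnWith_iteratedFDeriv_of_bound`), hence extends continuously to the two
CLOSED half-balls (Mathlib `continuousOn_extendFrom`), the two extensions agree at the simple points `x + t • v` of the wall
(`t ≠ 0` small, `v` the transversal direction), which accumulate at `x`.

What is NOT here: no group, no orbital integral, no chart; the one-wall agreement of jets from jump data is (GLUE-X-gen) and
its ray forms; the dress for the transfer family `transfFam` (which walls, which transversal directions, which bounds) is the
separate assembly file of the (M2) organ.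

## References
* A. Bouaziz, *Intégrales orbitales sur les groupes de Lie réductifs*, Ann. Sci. ÉNS (4) 27 (1994), §3.1–3.2 pp. 579–580.
* D. Shelstad, *Characters and inner forms of a quasi-split group over `ℝ`*, Compositio Math. 39 (1979), §4 pp. 22–31.
* J. Dieudonné, *Foundations of Modern Analysis* (1960), (8.6.3).
-/

noncomputable section

open Set Filter Metric Function
open scoped Topology NNReal ContDiff

namespace Literature.Analysis.Calculus

variable {E : Type*} [NormedAddCommGroup E] [NormedSpace ℝ E]
  {F : Type*} [NormedAddCommGroup F] [NormedSpace ℝ F] [CompleteSpace F]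

/-! ### §1 Hyperplanes are nowhere dense; the regular set of a finite arrangement is open and dense -/

section Density

omit [NormedSpace ℝ F] [CompleteSpace F] in
/-- A non-zero continuous linear form takes a positive value. [cite: Bouaziz1994IntegralesOrbitales, §3.2 (I₁)–(I₂) p. 579] -/
theorem exists_apply_pos_of_ne_zero {ℓ : E →L[ℝ] ℝ} (hℓ : ℓ ≠ 0) : ∃ v : E, 0 < ℓ v := by
  obtain ⟨v, hv⟩ : ∃ v : E, ℓ v ≠ 0 := by
    by_contra h
    push Not at h
    exact hℓ (ContinuousLinearMap.ext fun v => by simpa using h v)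
  rcases lt_or_gt_of_ne hv with h | h
  · exact ⟨-v, by simpa using h⟩
  · exact ⟨v, h⟩

/-- **The complement of ONE affine hyperplane `{ℓ = a}` (`ℓ ≠ 0`) is dense**: a wall point is a limit of points of the open
side `{a < ℓ}` (★ `mem_closure_inter_lt_apply`). [cite: Bouaziz1994IntegralesOrbitales, §3.2 (I₁)–(I₂) p. 579] -/
theorem dense_setOf_apply_ne {ℓ : E →L[ℝ] ℝ} (hℓ : ℓ ≠ 0) (a : ℝ) : Dense {y : E | ℓ y ≠ a} := by
  obtain ⟨v, hv⟩ := exists_apply_pos_of_ne_zero hℓ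
  intro x
  by_cases hx : ℓ x ≠ a
  · exact subset_closure hx
  · push Not at hx
    exact closure_mono (fun y hy => ne_of_gt hy.2) (mem_closure_inter_lt_apply (a := a) hx hv univ_mem)

variable {ι : Type*} (ℓ : ι → E →L[ℝ] ℝ) (a : ι → ℝ)

/-- The regular set `{∀ i ∈ T, ℓ i ≠ a i}` of a finite arrangement is open. [cite: Bouaziz1994IntegralesOrbitales, §3.2 (I₁)–(I₂) p. 579] -/
theorem isOpen_setOf_forall_apply_ne (T : Finset ι) : IsOpen {y : E | ∀ i ∈ T, ℓ i y ≠ a i} := by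
  have h : {y : E | ∀ i ∈ T, ℓ i y ≠ a i} = ⋂ i ∈ T, {y : E | ℓ i y ≠ a i} := by
    ext y; simp only [mem_setOf_eq, mem_iInter]
  rw [h]
  exact isOpen_biInter_finset fun i _ => isOpen_setOf_apply_ne (ℓ i) (a i)

/-- **The regular set `{∀ i ∈ T, ℓ i ≠ a i}` of a finite arrangement of (non-degenerate) hyperplanes is dense** (a finite
intersection of open dense sets). [cite: Bouaziz1994IntegralesOrbitales, §3.2 (I₁)–(I₂) p. 579] -/
theorem dense_setOf_forall_apply_ne (T : Finset ι) (hℓ : ∀ i ∈ T, ℓ i ≠ 0) : Dense {y : E | ∀ i ∈ T, ℓ i y ≠ a i} := by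
  classical
  induction T using Finset.induction_on with
  | empty => simp
  | insert i T hi IH =>
    have h : {y : E | ∀ j ∈ insert i T, ℓ j y ≠ a j} = {y : E | ℓ i y ≠ a i} ∩ {y : E | ∀ j ∈ T, ℓ j y ≠ a j} := by
      ext y; simp only [Finset.forall_mem_insert, mem_setOf_eq, mem_inter_iff]
    rw [h]
    exact (dense_setOf_apply_ne (hℓ i (Finset.mem_insert_self i T)) (a i)).inter_of_isOpen_left
      (IH fun j hj => hℓ j (Finset.mem_insert_of_mem hj)) (isOpen_setOf_apply_ne (ℓ i) (a i))

/-- A point of an open set `U` is a limit point of `U ∩ {∀ i ∈ T, ℓ i ≠ a i}`. [cite: Bouaziz1994IntegralesOrbitales, §3.2 (I₁)–(I₂) p. 579] -/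
theorem mem_closure_inter_setOf_forall_apply_ne (T : Finset ι) (hℓ : ∀ i ∈ T, ℓ i ≠ 0) {U : Set E} (hU : IsOpen U)
    {x : E} (hx : x ∈ U) : x ∈ closure (U ∩ {y : E | ∀ i ∈ T, ℓ i y ≠ a i}) :=
  (dense_setOf_forall_apply_ne ℓ a T hℓ).open_subset_closure_inter hU hx

end Density

/-! ### §2 Jets of a function smooth on an open set -/

section Jets

omit [CompleteSpace F] in
/-- On an open set where `g` is `C^∞`, every jet `Dⁿ g` is continuous. [cite: Bouaziz1994IntegralesOrbitales, §3.2 (I₁)–(I₂) p. 579] -/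
theorem continuousOn_iteratedFDeriv_of_isOpen {O : Set E} (hO : IsOpen O) {g : E → F} (hg : ContDiffOn ℝ ∞ g O) (n : ℕ) :
    ContinuousOn (iteratedFDeriv ℝ n g) O :=
  (hg.continuousOn_iteratedFDerivWithin (m := n) (by exact_mod_cast le_top) hO.uniqueDiffOn).congr
    fun z hz => (iteratedFDerivWithin_of_isOpen n hO hz).symm

omit [CompleteSpace F] in
/-- If `g` is `C^∞` on some neighbourhood of `x`, every jet `Dⁿ g` is continuous at `x`. [cite: Bouaziz1994IntegralesOrbitales, §3.2 (I₁)–(I₂) p. 579] -/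
theorem continuousAt_iteratedFDeriv_of_mem_nhds {V : Set E} {x : E} (hV : V ∈ 𝓝 x) {g : E → F} (hg : ContDiffOn ℝ ∞ g V)
    (n : ℕ) : ContinuousAt (iteratedFDeriv ℝ n g) x := by
  obtain ⟨O, hOV, hO, hxO⟩ := _root_.mem_nhds_iff.1 hV
  exact (continuousOn_iteratedFDeriv_of_isOpen hO (hg.mono hOV) n).continuousAt (hO.mem_nhds hxO)

omit [CompleteSpace F] in
/-- Two functions that agree on an open set have the same jets there. [cite: Bouaziz1994IntegralesOrbitales, §3.2 (I₁)–(I₂) p. 579] -/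
theorem iteratedFDeriv_eq_of_eqOn_isOpen {O : Set E} (hO : IsOpen O) {f g : E → F} (h : EqOn g f O) {y : E} (hy : y ∈ O)
    (n : ℕ) : iteratedFDeriv ℝ n g y = iteratedFDeriv ℝ n f y :=
  ((eventuallyEq_of_mem (hO.mem_nhds hy) h).iteratedFDeriv ℝ n).eq_of_nhds

end Jets

/-! ### §3 The main theorem: gluing across a finite transversal arrangement -/

section Arrangement

variable {ι : Type*} (ℓ : ι → E →L[ℝ] ℝ) (a : ι → ℝ)

/-- **SMOOTH GLUING ACROSS A FINITE TRANSVERSAL ARRANGEMENT OF HYPERPLANES.**  `U` open; walls `(ℓ i, a i)`, `i ∈ T`, with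
`ℓ i ≠ 0` and the transversality «at every point of the wall `i` in `U` some direction inside the wall `i` leaves every other
wall through that point»; `s := U ∩ {∀ i ∈ T, ℓ i ≠ a i}`; `f` `C^∞` on `s`, every jet `Dⁿ f` bounded on `s` near each wall
point of `U`; and the glue `extendFrom s f` `C^∞` on a neighbourhood of every SIMPLE wall point (on the wall `i`, off the walls
`j ≠ i`).  Then `extendFrom s f` is `C^∞` on `U` — the corners come for free.
[cite: Bouaziz1994IntegralesOrbitales, §3.2 (I₁)–(I₂) p. 579] -/
theorem contDiffOn_extendFrom_of_arrangement (T : Finset ι) (hℓ : ∀ i ∈ T, ℓ i ≠ 0) {U : Set E} (hU : IsOpen U)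
    (htrans : ∀ i ∈ T, ∀ x ∈ U, ℓ i x = a i → ∃ v : E, ℓ i v = 0 ∧ ∀ j ∈ T, j ≠ i → ℓ j x = a j → ℓ j v ≠ 0)
    {f : E → F} (hf : ContDiffOn ℝ ∞ f (U ∩ {y | ∀ i ∈ T, ℓ i y ≠ a i}))
    (hb : ∀ x ∈ U, (∃ i ∈ T, ℓ i x = a i) → ∀ n : ℕ, ∃ C : ℝ, ∀ᶠ y in 𝓝 x, (∀ i ∈ T, ℓ i y ≠ a i) → ‖iteratedFDeriv ℝ n f y‖ ≤ C)
    (hsimple : ∀ i ∈ T, ∀ x ∈ U, ℓ i x = a i → (∀ j ∈ T, j ≠ i → ℓ j x ≠ a j) →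
      ∃ V ∈ 𝓝 x, ContDiffOn ℝ ∞ (extendFrom (U ∩ {y | ∀ i ∈ T, ℓ i y ≠ a i}) f) V) :
    ContDiffOn ℝ ∞ (extendFrom (U ∩ {y | ∀ i ∈ T, ℓ i y ≠ a i}) f) U := by
  classical
  induction T using Finset.induction_on generalizing U with
  | empty =>
    -- no wall: the glue is `f` on `U = s`
    have hs : U ∩ {y : E | ∀ i ∈ (∅ : Finset ι), ℓ i y ≠ a i} = U := by
      ext y; simp
    rw [hs] at hf ⊢
    exact hf.congr fun y hy => extendFrom_extends hf.continuousOn y hy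
  | insert i T hi IH =>
    -- notation: the regular set `s`, the open complement `U′` of the new wall, the regular set `D` of the old walls
    set s : Set E := U ∩ {y : E | ∀ j ∈ insert i T, ℓ j y ≠ a j} with hsdef
    set U' : Set E := U ∩ {y : E | ℓ i y ≠ a i} with hU'def
    have hU' : IsOpen U' := hU.inter (isOpen_setOf_apply_ne (ℓ i) (a i))
    have hℓi : ℓ i ≠ 0 := hℓ i (Finset.mem_insert_self i T)
    have hℓT : ∀ j ∈ T, ℓ j ≠ 0 := fun j hj => hℓ j (Finset.mem_insert_of_mem hj)
    obtain ⟨w, hw⟩ := exists_apply_pos_of_ne_zero hℓi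
    have hsU' : U' ∩ {y : E | ∀ j ∈ T, ℓ j y ≠ a j} = s := by
      ext y
      simp only [hsdef, hU'def, Finset.forall_mem_insert, mem_inter_iff, mem_setOf_eq, and_assoc]
    have hs_open : IsOpen s := hU.inter (isOpen_setOf_forall_apply_ne ℓ a (insert i T))
    have hsU'sub : s ⊆ U' := fun y hy => ⟨hy.1, hy.2 i (Finset.mem_insert_self i T)⟩
    -- density of `s` in `U`
    have hdense : Dense {y : E | ∀ j ∈ insert i T, ℓ j y ≠ a j} := dense_setOf_forall_apply_ne ℓ a _ hℓ
    have hcl : ∀ {O : Set E}, IsOpen O → O ⊆ U → O ⊆ closure (O ∩ s) := by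
      intro O hO hOU y hy
      have h1 : y ∈ closure (O ∩ {y : E | ∀ j ∈ insert i T, ℓ j y ≠ a j}) := hdense.open_subset_closure_inter hO hy
      exact closure_mono (show O ∩ {y : E | ∀ j ∈ insert i T, ℓ j y ≠ a j} ⊆ O ∩ s from
        fun z hz => ⟨hz.1, hOU hz.1, hz.2⟩) h1
    -- STEP 1 (induction hypothesis on `U′`): the glue `g := extendFrom s f` is `C^∞` off the new wall
    have hg : ContDiffOn ℝ ∞ (extendFrom s f) U' := by
      -- transversality restricts to the old walls
      have htrans' : ∀ j ∈ T, ∀ x ∈ U', ℓ j x = a j → ∃ v : E, ℓ j v = 0 ∧ ∀ j' ∈ T, j' ≠ j → ℓ j' x = a j' → ℓ j' v ≠ 0 := by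
        intro j hj x hx hjx
        obtain ⟨v, hv0, hv⟩ := htrans j (Finset.mem_insert_of_mem hj) x hx.1 hjx
        exact ⟨v, hv0, fun j' hj' hne hj'x => hv j' (Finset.mem_insert_of_mem hj') hne hj'x⟩
      -- smoothness of `f` on the same regular set
      have hf' : ContDiffOn ℝ ∞ f (U' ∩ {y | ∀ j ∈ T, ℓ j y ≠ a j}) := by rw [hsU']; exact hf
      -- jet bounds: near a point of `U′` the new wall is absent
      have hb' : ∀ x ∈ U', (∃ j ∈ T, ℓ j x = a j) → ∀ n : ℕ, ∃ C : ℝ, ∀ᶠ y in 𝓝 x, (∀ j ∈ T, ℓ j y ≠ a j) →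
          ‖iteratedFDeriv ℝ n f y‖ ≤ C := by
        intro x hx hxT n
        obtain ⟨j, hj, hjx⟩ := hxT
        obtain ⟨C, hC⟩ := hb x hx.1 ⟨j, Finset.mem_insert_of_mem hj, hjx⟩ n
        refine ⟨C, ?_⟩
        have hev : ∀ᶠ y in 𝓝 x, ℓ i y ≠ a i := (isOpen_setOf_apply_ne (ℓ i) (a i)).mem_nhds hx.2
        filter_upwards [hC, hev] with y hy hyi hyT
        exact hy ((Finset.forall_mem_insert _ _ _).2 ⟨hyi, hyT⟩)
      -- simple points of the old walls inside `U′` are simple points in `U`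
      have hsimple' : ∀ j ∈ T, ∀ x ∈ U', ℓ j x = a j → (∀ j' ∈ T, j' ≠ j → ℓ j' x ≠ a j') →
          ∃ V ∈ 𝓝 x, ContDiffOn ℝ ∞ (extendFrom (U' ∩ {y | ∀ j ∈ T, ℓ j y ≠ a j}) f) V := by
        intro j hj x hx hjx hoth
        rw [hsU']
        refine hsimple j (Finset.mem_insert_of_mem hj) x hx.1 hjx fun j' hj' hne => ?_
        rcases Finset.mem_insert.1 hj' with h | h
        · subst h; exact hx.2
        · exact hoth j' h hne
      have h := IH hℓT hU' htrans' hf' hb' hsimple'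
      rw [hsU'] at h
      exact h
    -- the glue is `f` on `s`, and their jets agree there
    have hgf : EqOn (extendFrom s f) f s := fun y hy => extendFrom_extends hf.continuousOn y hy
    have hjet_gf : ∀ y ∈ s, ∀ n : ℕ, iteratedFDeriv ℝ n (extendFrom s f) y = iteratedFDeriv ℝ n f y :=
      fun y hy n => iteratedFDeriv_eq_of_eqOn_isOpen hs_open hgf hy n
    have hjet_cont : ∀ n : ℕ, ContinuousOn (iteratedFDeriv ℝ n (extendFrom s f)) U' :=
      fun n => continuousOn_iteratedFDeriv_of_isOpen hU' hg n
    -- STEP 2: the jets of the glue are bounded off the new wall near each of its points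
    have hbg : ∀ x ∈ U, ℓ i x = a i → ∀ n : ℕ, ∃ C : ℝ, ∀ᶠ y in 𝓝 x, ℓ i y ≠ a i →
        ‖iteratedFDeriv ℝ n (extendFrom s f) y‖ ≤ C := by
      intro x hx hxi n
      obtain ⟨C, hC⟩ := hb x hx ⟨i, Finset.mem_insert_self i T, hxi⟩ n
      obtain ⟨O, hOsub, hO, hxO⟩ := _root_.mem_nhds_iff.1 (inter_mem hC (hU.mem_nhds hx))
      refine ⟨C, eventually_of_mem (hO.mem_nhds hxO) fun y hy hyi => ?_⟩
      -- `y ∈ O ∩ U′`: a limit of points of `s`, where the bound holds for the jets of `f = g`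
      have hyU : y ∈ U := (hOsub hy).2
      have hOU' : IsOpen (O ∩ U') := hO.inter hU'
      have hyO : y ∈ O ∩ U' := ⟨hy, hyU, hyi⟩
      have hycl : y ∈ closure ((O ∩ U') ∩ s) := hcl hOU' (fun z hz => hz.2.1) hyO
      haveI : (𝓝[(O ∩ U') ∩ s] y).NeBot := mem_closure_iff_nhdsWithin_neBot.1 hycl
      have ht : Tendsto (fun z => ‖iteratedFDeriv ℝ n (extendFrom s f) z‖) (𝓝[(O ∩ U') ∩ s] y)
          (𝓝 ‖iteratedFDeriv ℝ n (extendFrom s f) y‖) :=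
        (continuous_norm.continuousAt.comp_continuousWithinAt (hjet_cont n y ⟨hyU, hyi⟩)).mono_left
          (nhdsWithin_mono y (show (O ∩ U') ∩ s ⊆ U' from fun z hz => hz.1.2))
      refine le_of_tendsto ht (eventually_of_mem self_mem_nhdsWithin fun z hz => ?_)
      rw [hjet_gf z hz.2 n]
      exact (hOsub hz.1.1).1 hz.2.2
    -- STEP 3: glue across the new wall
    have hG := contDiffOn_extendFrom_of_oneSidedLimits_eq (ℓ i) (a i) (ne_of_gt hw) hU (f := extendFrom s f)
      (by rw [← hU'def]; exact hg) hbg ?_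
    · -- the result IS the glue `extendFrom s f` (both extend `f` continuously from the dense `s`)
      refine hG.congr fun y hy => ?_
      have hGc : ContinuousAt (extendFrom (U ∩ {y | ℓ i y ≠ a i}) (extendFrom s f)) y :=
        (hG.continuousOn y hy).continuousAt (hU.mem_nhds hy)
      refine extendFrom_eq (hcl hU Subset.rfl hy |> closure_mono inter_subset_right) ?_
      refine (hGc.tendsto.mono_left nhdsWithin_le_nhds).congr' (eventually_of_mem self_mem_nhdsWithin fun z hz => ?_)
      rw [← hU'def, extendFrom_extends hg.continuousOn z (hsU'sub hz), hgf hz]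
    -- STEP 4: agreement of the one-sided limits of the jets of the glue at the points of the new wall
    intro x hx hxi n l₁ l₂ h₁ h₂
    by_cases hsim : ∀ j ∈ T, ℓ j x ≠ a j
    · -- a SIMPLE point of the new wall: the glue is `C^∞` near `x`
      obtain ⟨V, hV, hgV⟩ := hsimple i (Finset.mem_insert_self i T) x hx hxi fun j hj hne =>
        hsim j ((Finset.mem_insert.1 hj).resolve_left hne)
      have hc : ContinuousAt (iteratedFDeriv ℝ n (extendFrom s f)) x := continuousAt_iteratedFDeriv_of_mem_nhds hV hgV n
      haveI : (𝓝[{y : E | a i < ℓ i y}] x).NeBot := by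
        have := mem_closure_inter_lt_apply (a := a i) hxi hw univ_mem
        rw [univ_inter] at this
        exact mem_closure_iff_nhdsWithin_neBot.1 this
      haveI : (𝓝[{y : E | ℓ i y < a i}] x).NeBot := by
        have := mem_closure_inter_apply_lt (a := a i) hxi hw univ_mem
        rw [univ_inter] at this
        exact mem_closure_iff_nhdsWithin_neBot.1 this
      rw [tendsto_nhds_unique h₁ (hc.tendsto.mono_left nhdsWithin_le_nhds),
        tendsto_nhds_unique h₂ (hc.tendsto.mono_left nhdsWithin_le_nhds)]
    · -- a CORNER: `x` lies on some old wall too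
      push Not at hsim
      -- a transversal direction inside the new wall
      obtain ⟨v, hv0, hv⟩ := htrans i (Finset.mem_insert_self i T) x hx hxi
      -- a ball in `U` on which `Dⁿ⁺¹ g` is bounded off the new wall
      obtain ⟨C, hC⟩ := hbg x hx hxi (n + 1)
      obtain ⟨r, hr, hball⟩ := Metric.mem_nhds_iff.1 (inter_mem hC (hU.mem_nhds hx))
      have hBU : ball x r ⊆ U := fun y hy => (hball hy).2
      have hBC : ∀ y ∈ ball x r, ℓ i y ≠ a i → ‖iteratedFDeriv ℝ (n + 1) (extendFrom s f) y‖ ≤ C :=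
        fun y hy hyi => (hball hy).1 hyi
      -- the two open half-balls, convex pieces of `U′`
      set Bp : Set E := ball x r ∩ {y : E | a i < ℓ i y} with hBpdef
      set Bm : Set E := ball x r ∩ {y : E | ℓ i y < a i} with hBmdef
      have hBpU' : Bp ⊆ U' := fun y hy => ⟨hBU hy.1, ne_of_gt hy.2⟩
      have hBmU' : Bm ⊆ U' := fun y hy => ⟨hBU hy.1, ne_of_lt hy.2⟩
      have hBp_conv : Convex ℝ Bp := (convex_ball x r).inter (convex_setOf_lt_apply (ℓ i) (a i))
      have hBm_conv : Convex ℝ Bm := (convex_ball x r).inter (convex_setOf_apply_lt (ℓ i) (a i))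
      -- `Dⁿ g` is Lipschitz on each half-ball, hence has limits at the points of their closures
      have hCnn : ∀ y ∈ Bp, ‖iteratedFDeriv ℝ (n + 1) (extendFrom s f) y‖ ≤ (⟨max C 0, le_max_right _ _⟩ : ℝ≥0) :=
        fun y hy => (hBC y hy.1 (ne_of_gt hy.2)).trans (le_max_left _ _)
      have hCnn' : ∀ y ∈ Bm, ‖iteratedFDeriv ℝ (n + 1) (extendFrom s f) y‖ ≤ (⟨max C 0, le_max_right _ _⟩ : ℝ≥0) :=
        fun y hy => (hBC y hy.1 (ne_of_lt hy.2)).trans (le_max_left _ _)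
      have hlim_p : ∀ z ∈ closure Bp, ∃ l, Tendsto (iteratedFDeriv ℝ n (extendFrom s f)) (𝓝[Bp] z) (𝓝 l) := fun z hz =>
        (lipschitzOnWith_iteratedFDeriv_of_bound hU' hBp_conv hBpU' hg hCnn).uniformContinuousOn.exists_tendsto_of_mem_closure hz
      have hlim_m : ∀ z ∈ closure Bm, ∃ l, Tendsto (iteratedFDeriv ℝ n (extendFrom s f)) (𝓝[Bm] z) (𝓝 l) := fun z hz =>
        (lipschitzOnWith_iteratedFDeriv_of_bound hU' hBm_conv hBmU' hg hCnn').uniformContinuousOn.exists_tendsto_of_mem_closure hz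
      -- the continuous extensions `q±` of `Dⁿ g` to the closed half-balls
      set qp : E → E [×n]→L[ℝ] F := extendFrom Bp (iteratedFDeriv ℝ n (extendFrom s f)) with hqpdef
      set qm : E → E [×n]→L[ℝ] F := extendFrom Bm (iteratedFDeriv ℝ n (extendFrom s f)) with hqmdef
      have hqp_cont : ContinuousOn qp (closure Bp) := continuousOn_extendFrom Subset.rfl hlim_p
      have hqm_cont : ContinuousOn qm (closure Bm) := continuousOn_extendFrom Subset.rfl hlim_m
      have hqp_tend : ∀ z ∈ closure Bp, Tendsto (iteratedFDeriv ℝ n (extendFrom s f)) (𝓝[Bp] z) (𝓝 (qp z)) :=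
        fun z hz => tendsto_extendFrom (hlim_p z hz)
      have hqm_tend : ∀ z ∈ closure Bm, Tendsto (iteratedFDeriv ℝ n (extendFrom s f)) (𝓝[Bm] z) (𝓝 (qm z)) :=
        fun z hz => tendsto_extendFrom (hlim_m z hz)
      -- wall points of the ball lie in both closures
      have hwall_p : ∀ z ∈ ball x r, ℓ i z = a i → z ∈ closure Bp :=
        fun z hz hzi => mem_closure_inter_lt_apply hzi hw (isOpen_ball.mem_nhds hz)
      have hwall_m : ∀ z ∈ ball x r, ℓ i z = a i → z ∈ closure Bm :=
        fun z hz hzi => mem_closure_inter_apply_lt hzi hw (isOpen_ball.mem_nhds hz)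
      have hxB : x ∈ ball x r := mem_ball_self hr
      -- the given one-sided limits are the values of `q±` at `x`
      have hl₁ : l₁ = qp x := by
        haveI : (𝓝[Bp] x).NeBot := mem_closure_iff_nhdsWithin_neBot.1 (hwall_p x hxB hxi)
        have h : Tendsto (iteratedFDeriv ℝ n (extendFrom s f)) (𝓝[Bp] x) (𝓝 l₁) := by
          rw [hBpdef, nhdsWithin_inter_eq_of_isOpen isOpen_ball hxB]; exact h₁
        exact tendsto_nhds_unique h (hqp_tend x (hwall_p x hxB hxi))
      have hl₂ : l₂ = qm x := by
        haveI : (𝓝[Bm] x).NeBot := mem_closure_iff_nhdsWithin_neBot.1 (hwall_m x hxB hxi)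
        have h : Tendsto (iteratedFDeriv ℝ n (extendFrom s f)) (𝓝[Bm] x) (𝓝 l₂) := by
          rw [hBmdef, nhdsWithin_inter_eq_of_isOpen isOpen_ball hxB]; exact h₂
        exact tendsto_nhds_unique h (hqm_tend x (hwall_m x hxB hxi))
      -- at a SIMPLE wall point `z` of the ball, `q⁺ z = Dⁿ g z = q⁻ z`
      have hsimple_eq : ∀ z ∈ ball x r, ℓ i z = a i → (∀ j ∈ T, ℓ j z ≠ a j) → qp z = qm z := by
        intro z hz hzi hzT
        obtain ⟨V, hV, hgV⟩ := hsimple i (Finset.mem_insert_self i T) z (hBU hz) hzi fun j hj hne =>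
          hzT j ((Finset.mem_insert.1 hj).resolve_left hne)
        have hc : ContinuousAt (iteratedFDeriv ℝ n (extendFrom s f)) z := continuousAt_iteratedFDeriv_of_mem_nhds hV hgV n
        have e1 : qp z = iteratedFDeriv ℝ n (extendFrom s f) z := by
          haveI : (𝓝[Bp] z).NeBot := mem_closure_iff_nhdsWithin_neBot.1 (hwall_p z hz hzi)
          exact tendsto_nhds_unique (hqp_tend z (hwall_p z hz hzi)) (hc.tendsto.mono_left nhdsWithin_le_nhds)
        have e2 : qm z = iteratedFDeriv ℝ n (extendFrom s f) z := by
          haveI : (𝓝[Bm] z).NeBot := mem_closure_iff_nhdsWithin_neBot.1 (hwall_m z hz hzi)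
          exact tendsto_nhds_unique (hqm_tend z (hwall_m z hz hzi)) (hc.tendsto.mono_left nhdsWithin_le_nhds)
        rw [e1, e2]
      -- the simple points `x + t • v`, `t ≠ 0` small, accumulate at `x`
      have hray0 : Tendsto (fun t : ℝ => x + t • v) (𝓝 0) (𝓝 x) := by
        have : Continuous fun t : ℝ => x + t • v := by fun_prop
        simpa using this.tendsto 0
      have hray_wall : ∀ t : ℝ, ℓ i (x + t • v) = a i := fun t => by simp [hxi, hv0]
      have hev_ball : ∀ᶠ t : ℝ in 𝓝 0, x + t • v ∈ ball x r := hray0.eventually (isOpen_ball.mem_nhds hxB)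
      have hev_simple : ∀ᶠ t : ℝ in 𝓝[≠] 0, ∀ j ∈ T, ℓ j (x + t • v) ≠ a j := by
        have hfin : ∀ j ∈ T, ∀ᶠ t : ℝ in 𝓝[≠] 0, ℓ j (x + t • v) ≠ a j := by
          intro j hj
          by_cases hjx : ℓ j x = a j
          · have hjv : ℓ j v ≠ 0 := hv j (Finset.mem_insert_of_mem hj) (fun h => hi (h ▸ hj)) hjx
            filter_upwards [self_mem_nhdsWithin] with t (ht : t ≠ 0)
            simp only [map_add, map_smul, smul_eq_mul, hjx, ne_eq, add_eq_left, mul_eq_zero, not_or]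
            exact ⟨ht, hjv⟩
          · have hopen : IsOpen {y : E | ℓ j y ≠ a j} := isOpen_setOf_apply_ne (ℓ j) (a j)
            exact (hray0.eventually (hopen.mem_nhds hjx)).filter_mono nhdsWithin_le_nhds
        exact (Finset.eventually_all T).2 hfin |>.mono fun t ht j hj => ht j hj
      have hev_eq : ∀ᶠ t : ℝ in 𝓝[≠] 0, qp (x + t • v) = qm (x + t • v) := by
        filter_upwards [hev_simple, hev_ball.filter_mono nhdsWithin_le_nhds] with t ht htb
        exact hsimple_eq _ htb (hray_wall t) ht
      -- continuity of `q±` along the ray within the closed half-balls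
      have hray_p : Tendsto (fun t : ℝ => x + t • v) (𝓝[≠] 0) (𝓝[closure Bp] x) :=
        tendsto_nhdsWithin_iff.2 ⟨hray0.mono_left nhdsWithin_le_nhds,
          (hev_ball.filter_mono nhdsWithin_le_nhds).mono fun t ht => hwall_p _ ht (hray_wall t)⟩
      have hray_m : Tendsto (fun t : ℝ => x + t • v) (𝓝[≠] 0) (𝓝[closure Bm] x) :=
        tendsto_nhdsWithin_iff.2 ⟨hray0.mono_left nhdsWithin_le_nhds,
          (hev_ball.filter_mono nhdsWithin_le_nhds).mono fun t ht => hwall_m _ ht (hray_wall t)⟩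
      have htp : Tendsto (fun t : ℝ => qp (x + t • v)) (𝓝[≠] 0) (𝓝 (qp x)) :=
        (hqp_cont x (hwall_p x hxB hxi)).tendsto.comp hray_p
      have htm : Tendsto (fun t : ℝ => qm (x + t • v)) (𝓝[≠] 0) (𝓝 (qm x)) :=
        (hqm_cont x (hwall_m x hxB hxi)).tendsto.comp hray_m
      rw [hl₁, hl₂]
      exact tendsto_nhds_unique_of_eventuallyEq htp htm hev_eq

end Arrangement

end Literature.Analysis.Calculus

end
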